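import Summits.QuantumFields.BalabanUV.T4Continuum.Support.ShellMeasureAverageMajorant
import Literature.MathematicalPhysics.QuantumFieldTheory.Balaban1983to89.B7Prop3GeneralLinearPdev

/-!
# `T4Continuum.ShellMeasureAverageMajorantPdev` — [B7] (139) at a general regular background in majorant form, THE
# CONSUMER SHAPES for row S68 (c) (leaf-10 lineage's k-fold induction, journal l.16058): the PLAQUETTE-DEVIATION currency
# `pdev V₀ ≤ β ≤ βmax` of `B7Prop2Explicit`∕`B7Prop4GeneralLevels` (as in `B7Prop3GeneralLinearPdev.norm_linQcov_le_of_pdev`),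
# an arbitrary pointwise MAJORANT `g ≥ |A|` (monotonicity of `Q`, `Q″`), and print's `Q` as the explicit straight-segment
# sum over `r : Fin d → Fin L`, `l < L` (cell `pub-balaban`, sub-cell `t4`, NE7c ROUND-2 crew row S68 (a), file 3; unit
# `b2b-balaban-t4-ne7c-formalise-leaf-05` gen 7; ADDITIVE — imports file 2 `ShellMeasureAverageMajorant` and the S55 file
# `B7Prop3GeneralLinearPdev` (for `le_pdev`'s currency) ONLY; [folklore]; 0 def, 0 sorry)

HONEST FRAMING (cell).  Bookkeeping corollaries of `ShellMeasureAverageMajorant.norm_linQcov_le_majorant_of_plaquettes`;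
[Balaban1985Averaging] (139)∕(140) p. 39 are LOCATORS for the SHAPE (the paper is under adjudication — ABSOLUTE RULE),
nothing printed is asserted; no `def … : Prop`; nothing of Bałaban's live-level estimates is discharged; NE7c NOT PRINTED,
NOT PROVED; spine PROVED 0∕9; rung (B)+1 on a finite T⁴ — NOT infinite volume, NOT mass gap, NOT Clay.  HONEST DEPENDENCY:
continuum YM on T⁴ ⇐ BetaPertH ∧ nine spine estimates (0/9 proved); BetaPertH ⇐ (D1) ∧ (D4) ∧ CAP+tail; G-an2-4 gates asym, D1
and NE2/3/4.

WHAT THIS FILE PROVES (kernel): `Qav_eq_sum_boxVec` (print's `Q` = the Fin-indexed straight-segment sum in b07's corner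
coordinates — leaf-10-g10's wish (1)); `norm_linQcov_le_majorant_mono` (any pointwise majorant `g ≥ |A|`);
**`norm_linQcov_le_majorant_of_pdev`** (`pdev V₀ ≤ β ≤ 1∕(1024(d+1)(d+4)L²)` ⟹ `‖L(Q(V₀)A)_c‖ ≤ L·(Qav L g) c +
1600(d+1)(d+4)L^{d+2}β·(Qdd L g) c` for every `g ≥ |A|`); **`qcov_le_majorant_of_pdev`** (the Pi-inequality of bond functions
`(c ↦ L⁻¹‖L(Q(V₀)A)_c‖) ≤ Qav L g + (1600(d+1)(d+4)L^{d+1}β) • Qdd L g` — the `h139` shape of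
`B7BlockGeometry.ineq143_succ_lattice` ∕ of leaf-10-g10's F2 hypothesis, at every level background by `level_regularity`).
-/

noncomputable section

open scoped BigOperators
open NormedSpace Finset

namespace Summit.QuantumFields.BalabanUV.T4Continuum.ShellMeasureAverageMajorantPdev

open Literature.MathematicalPhysics.QuantumFieldTheory.Balaban1983to89
open Literature.MathematicalPhysics.QuantumLattice (ZdEdge blockBase blockSites)
open B7Prop1Explicit B7Prop2Explicit B7Prop3GeneralLinear B7Prop3GeneralLinearBound
open B7BlockGeometry (Qav Qdd Qav_apply Qav_monotone Qdd_monotone)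
open ShellMeasureAveragePathMass ShellMeasureAverageMajorant

export B7Prop1Explicit (Site)

variable {d : ℕ}

variable {𝔸 : Type*} [NormedRing 𝔸] [NormedAlgebra ℂ 𝔸] [NormOneClass 𝔸] [CompleteSpace 𝔸]
variable (L : ℕ)

omit [NormedAlgebra ℂ 𝔸] [NormOneClass 𝔸] [CompleteSpace 𝔸] in
/-- PRINT'S `Q` ([2] (1.11)) AS THE FIN-INDEXED STRAIGHT-SEGMENT SUM in b07's corner coordinates:
`(Qav L g)(y, κ) = Σ_{r : Fin d → Fin L} Σ_{l < L} L^{−(d+1)}·g(L·y + r + l·e_κ, κ)`.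
[cite: Balaban1984PropagatorsI, (1.11) p.19] [cite: Balaban1985Averaging, (139) p.39] -/
theorem Qav_eq_sum_boxVec (hL : 0 < L) (g : ZdEdge d → ℝ) (y : Site d) (κ : Fin d) :
    Qav L g (y, κ) = ∑ r : Fin d → Fin L, ∑ l ∈ range L,
      ((L : ℝ) ^ (d + 1))⁻¹ * g (blockBase L y + boxVec L r + (l : ℤ) • e κ, κ) := by
  rw [Qav_apply, sum_blockSites_eq_sum_boxVec L hL]
  refine sum_congr rfl fun r _ => sum_congr rfl fun l _ => ?_
  rw [zsmul_e]

variable {V₀ : Site d → Fin d → 𝔸ˣ} (hV₀ : ∀ x κ, V₀ x κ ∈ U1 𝔸) {A : Site d → Fin d → 𝔸} (hL : 1 ≤ L) (y : Site d)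
  (κ : Fin d) {g : ZdEdge d → ℝ} (hg : ∀ x μ, ‖A x μ‖ ≤ g (x, μ))

include hV₀ hL hg in
/-- (139) with an arbitrary POINTWISE MAJORANT `g ≥ |A|` (monotonicity of `Q`, `Q″`), loop regime: for block loops
`‖W_x − 1‖ ≤ ε ≤ 1∕8` at `c`, `‖L(Q(V₀)A)_c‖ ≤ L·(Qav L g) c + 100·ε·Lᵈ·(Qdd L g) c`. [cite: Balaban1985Averaging, (139)-(140) p.39] -/
theorem norm_linQcov_le_majorant_mono {ε : ℝ} (hε0 : 0 ≤ ε) (hε : ε ≤ 1 / 8)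
    (hW : ∀ r : Fin d → Fin L, ‖((Wcx L V₀ (blockBase L y) κ (boxVec L r) : 𝔸ˣ) : 𝔸) - 1‖ ≤ ε) :
    ‖linQcov L V₀ A (blockBase L y) κ‖ ≤ L * Qav L g (y, κ) + 100 * ε * (L : ℝ) ^ d * Qdd L g (y, κ) := by
  have hle : (fun b : ZdEdge d => ‖A b.1 b.2‖) ≤ g := fun b => hg b.1 b.2
  have h1 : Qav L (fun b : ZdEdge d => ‖A b.1 b.2‖) (y, κ) ≤ Qav L g (y, κ) := Qav_monotone L hle (y, κ)
  have h2 : Qdd L (fun b : ZdEdge d => ‖A b.1 b.2‖) (y, κ) ≤ Qdd L g (y, κ) := Qdd_monotone L hle (y, κ)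
  have h := norm_linQcov_le_majorant L hV₀ A hL y κ hε0 hε hW
  have hLd : (0 : ℝ) ≤ 100 * ε * (L : ℝ) ^ d := by positivity
  nlinarith [mul_le_mul_of_nonneg_left h1 (Nat.cast_nonneg L), mul_le_mul_of_nonneg_left h2 hLd]

include hV₀ hL hg in
/-- **(139) IN THE PLAQUETTE-DEVIATION CURRENCY** (as `B7Prop3GeneralLinearPdev.norm_linQcov_le_of_pdev`, the binder style
of `B7Prop4GeneralLevels.prop4_general_of_prop3`): for a `U1` background with `pdev V₀ ≤ β ≤ 1∕(1024(d+1)(d+4)L²)` and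
any majorant `g ≥ |A|`, `‖L(Q(V₀)A)_c‖ ≤ L·(Qav L g) c + 1600(d+1)(d+4)·L^{d+2}·β·(Qdd L g) c` — (139) with
`C′₁L²α₀ ↦ 1600(d+1)(d+4)L^{d+1}β` after dividing the «L(Q(V₀)A)_c» factor `L`. [cite: Balaban1985Averaging, (139)-(140) p.39] -/
theorem norm_linQcov_le_majorant_of_pdev {β : ℝ} (hβ0 : 0 ≤ β) (hβ : pdev V₀ ≤ β)
    (hβmax : β ≤ 1 / (1024 * ((d : ℝ) + 1) * ((d : ℝ) + 4) * (L : ℝ) ^ 2)) :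
    ‖linQcov L V₀ A (blockBase L y) κ‖ ≤
      L * Qav L g (y, κ) + 1600 * ((d : ℝ) + 1) * ((d : ℝ) + 4) * (L : ℝ) ^ (d + 2) * β * Qdd L g (y, κ) := by
  have hX : (0 : ℝ) < 1024 * ((d : ℝ) + 1) * ((d : ℝ) + 4) * (L : ℝ) ^ 2 := by
    have hL0 : (0 : ℝ) < L := by exact_mod_cast hL
    positivity
  have hXβ : 1024 * ((d : ℝ) + 1) * ((d : ℝ) + 4) * (L : ℝ) ^ 2 * β ≤ 1 := by
    have := mul_le_mul_of_nonneg_left hβmax hX.le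
    rwa [one_div, mul_inv_cancel₀ hX.ne'] at this
  have h44 : ∀ (x : Site d) (κ κ' : Fin d), κ ≠ κ' → ‖((hol V₀ x (plaqWord κ κ') : 𝔸ˣ) : 𝔸) - 1‖ ≤ β :=
    fun x κ κ' _ => (le_pdev hV₀ x κ κ').trans hβ
  have hDL : (0 : ℝ) ≤ ((d : ℝ) + 1) * ((d : ℝ) + 4) * (L : ℝ) ^ 2 * β := by positivity
  -- block loops from plaquettes (Prop. 1's mechanism), then the loop-regime majorant with `g`
  have hWε : ∀ r : Fin d → Fin L, ‖((Wcx L V₀ (blockBase L y) κ (boxVec L r) : 𝔸ˣ) : 𝔸) - 1‖ ≤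
      16 * (d + 1) * (d + 4) * (L : ℝ) ^ 2 * β := fun r =>
    (B7Prop2Explicit.norm_Wcx_sub_one_le L hL V₀ hV₀ hβ0 (by nlinarith) h44 (blockBase L y) κ r).trans (le_of_eq (by ring))
  have h := norm_linQcov_le_majorant_mono L hV₀ hL y κ hg (by positivity) (by nlinarith) hWε
  refine h.trans (le_of_eq ?_)
  ring

end Summit.QuantumFields.BalabanUV.T4Continuum.ShellMeasureAverageMajorantPdev

namespace Summit.QuantumFields.BalabanUV.T4Continuum.ShellMeasureAverageMajorantPdev

open Literature.MathematicalPhysics.QuantumFieldTheory.Balaban1983to89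
open Literature.MathematicalPhysics.QuantumLattice (ZdEdge blockBase)
open B7Prop1Explicit B7Prop2Explicit B7Prop3GeneralLinear
open B7BlockGeometry (Qav Qdd)

variable {d : ℕ} {𝔸 : Type*} [NormedRing 𝔸] [NormedAlgebra ℂ 𝔸] [NormOneClass 𝔸] [CompleteSpace 𝔸] (L : ℕ)

/-- **THE `h139` SHAPE IN THE `pdev` CURRENCY**: for a `U1` background with `pdev V₀ ≤ β ≤ 1∕(1024(d+1)(d+4)L²)` and any
majorant `g ≥ |A|`, the bond functions satisfy
`(c ↦ L⁻¹‖L(Q(V₀)A)_c‖) ≤ Qav L g + (1600(d+1)(d+4)·L^{d+1}·β) • Qdd L g` — literally the per-level input of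
`B7BlockGeometry.ineq143_succ_lattice` (choose `2·C₁′·α₀·s := 1600(d+1)(d+4)L^{d+1}β`). [cite: Balaban1985Averaging, (139)-(140) p.39] -/
theorem qcov_le_majorant_of_pdev {V₀ : Site d → Fin d → 𝔸ˣ} (hV₀ : ∀ x κ, V₀ x κ ∈ U1 𝔸) {A : Site d → Fin d → 𝔸}
    (hL : 1 ≤ L) {g : ZdEdge d → ℝ} (hg : ∀ x μ, ‖A x μ‖ ≤ g (x, μ)) {β : ℝ} (hβ0 : 0 ≤ β) (hβ : pdev V₀ ≤ β)
    (hβmax : β ≤ 1 / (1024 * ((d : ℝ) + 1) * ((d : ℝ) + 4) * (L : ℝ) ^ 2)) :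
    (fun c : ZdEdge d => (L : ℝ)⁻¹ * ‖linQcov L V₀ A (blockBase L c.1) c.2‖) ≤
      Qav L g + (1600 * ((d : ℝ) + 1) * ((d : ℝ) + 4) * (L : ℝ) ^ (d + 1) * β) • Qdd L g := by
  intro c
  have hL0 : (0 : ℝ) < L := by exact_mod_cast hL
  have h := norm_linQcov_le_majorant_of_pdev L hV₀ hL c.1 c.2 hg hβ0 hβ hβmax
  simp only [Pi.add_apply, Pi.smul_apply, smul_eq_mul]
  rw [inv_mul_le_iff₀ hL0]
  refine h.trans (le_of_eq ?_)
  ring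

end Summit.QuantumFields.BalabanUV.T4Continuum.ShellMeasureAverageMajorantPdev

end
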